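/-
Origin: expansion seat `planner-pub-hodgecm-pv14-g5-0`, handover #3 2026-08-18T09:46:37Z (`HOME/pub-hodgecm-pv14-g5/lean/Pv14g5/WeilThetaModelPoissonLattice.lean`, md5 3fd40f40, 181 lines);
landed by the gen-7 packager in gate run 28 as `HodgeCM/Automorphic/WeilThetaModelPoissonLattice.lean` (import ^import Pv14g5\.→import HodgeCM.Automorphic. ×1; import ^import Pv14g4\.→import HodgeCM.Automorphic. ×1).
-/
/-
Origin: HOME/pub-hodgecm-pv14-g5/lean/Pv14g5/WeilThetaModelPoissonLattice.lean — session planner-pub-hodgecm-pv14-g5-0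
(unit pub-hodgecm-pv14-g5, DAG-node prover #14 gen 5).  Intended final place:
`HodgeCM/Automorphic/WeilThetaModelPoissonLattice.lean` (namespace `HodgeCM.SchwartzWeil`).
PACKAGER: rewrite `import Pv14g4.WeilThetaModelSchrodinger` to `import HodgeCM.Automorphic.WeilThetaModelSchrodinger`
(pv14-g4 HANDOVER #2, t27) and `import Pv14g5.PoissonSummationDual` to `import HodgeCM.Automorphic.PoissonSummationDual`
(this seat's HANDOVER #2); Mathlib otherwise.  Asserts nothing (no `axiom`, no new constants).
-/
import Summits.HodgeConjecture.HodgeCM.Automorphic.WeilThetaModelSchrodinger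
import Summits.HodgeConjecture.HodgeCM.Automorphic.PoissonSummationDual

/-!
# The Weyl element at the real place in ANY rank: Poisson summation in the Schrödinger–lattice model

Weil 1964 (Acta Math. 111) n° 41, formula (39), p. 193: `Σ_{ξ ∈ X_k} Φ(ξ) = Σ_{ξ ∈ X_k} (r_k(s) Φ)(ξ)`,
"égalité qui ... se réduit à la formule de Poisson lorsque `s = d'(γ)`".  pv14-g4's leaf `WeilThetaModelPoisson`
recorded the kernel form of this for `X_∞ = ℝ ⊃ ℤ` only (Mathlib's Poisson summation is one-dimensional).  With the
d-dimensional Poisson summation of this seat (`PoissonSummationLattice`, `PoissonSummationDual`) the same statements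
hold for the Schrödinger–lattice model `HodgeCM.SchwartzWeil.schrodingerModel E L m` of ANY finite-dimensional real
inner product space `E` and ANY full lattice `L`, with the dual lattice `L*` and the covolume in their proper places:

* `dualLattice_span_orthonormalBasis` — the `ℤ`-span of an orthonormal basis is self-dual (so self-dual lattices
  exist in every rank: `ℤⁿ ⊂ ℝⁿ`);
* `thetaCLM_dualLattice_fourier : Θ_{L*}(𝓕 Φ)(0) = covol(L) · Θ_L(Φ)(0)` and the shifted form
  `thetaCLM_dualLattice_fourier_apply` (theta DISTRIBUTIONS `thetaCLM`, pv14-g4 #1);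
* `theta_dualLattice_fourier_one : theta E L* m (𝓕 Φ) 1 = covol(L) · theta E L m Φ 1` and the closed form away
  from the base point `theta_dualLattice_fourier : theta E L* m (𝓕 Φ) (a, u) = u^m covol(L) Σ_{v ∈ L} Φ(v) 𝐞⟪v, a⟫`
  (the Weyl element turns the translation `a` into the character `v ↦ 𝐞⟪v, a⟫` — theta-level shadow only);
* self-dual `L`: `theta_fourier_one_of_dualLattice_eq : theta E L m (𝓕 Φ) 1 = theta E L m Φ 1`, and the same
  through the `WeilThetaDatum` / `WeilThetaModel` records (`datum_theta_fourier_one_of_dualLattice_eq`,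
  `schrodingerModel_θ_fourier_one_of_dualLattice_eq`).

LABELS.  Every statement is KERNEL (Mathlib + landed `LatticeTheta` + pv14-g4 #1/#2 + this seat's #1/#2).  NOT claimed
(unchanged, GAPS pv14g4-K1 / pv14g5-K1): the Weyl element is not adjoined to the model's group `Mp = E × U(1)`
(no modulation operators, no metaplectic cocycle); finite places untouched.  No PerL / QW8 / 2001 statement is used.
-/

set_option autoImplicit false

noncomputable section

open MeasureTheory Module Submodule
open scoped RealInnerProductSpace FourierTransform SchwartzMap

namespace HodgeCM

/-! ## 0. Self-dual lattices exist in every rank: the `ℤ`-span of an orthonormal basis -/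

namespace PoissonSummation

variable {V : Type*} [NormedAddCommGroup V] [InnerProductSpace ℝ V]

/-- An orthonormal basis is its own dual basis for `innerₗ V`. -/
theorem dualBasis_orthonormalBasis {ι : Type*} [Fintype ι] [DecidableEq ι] (ob : OrthonormalBasis ι ℝ V) :
    LinearMap.BilinForm.dualBasis (innerₗ V) innerₗ_nondegenerate ob.toBasis = ob.toBasis := by
  refine Basis.eq_of_apply_eq fun i => ?_
  have key : ∀ j, ⟪ob j, LinearMap.BilinForm.dualBasis (innerₗ V) innerₗ_nondegenerate ob.toBasis i⟫ =
      if j = i then 1 else 0 := by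
    intro j
    rw [real_inner_comm, ← ob.coe_toBasis]
    exact LinearMap.BilinForm.apply_dualBasis_left innerₗ_nondegenerate ob.toBasis i j
  calc LinearMap.BilinForm.dualBasis (innerₗ V) innerₗ_nondegenerate ob.toBasis i
      = ∑ j, ⟪ob j, LinearMap.BilinForm.dualBasis (innerₗ V) innerₗ_nondegenerate ob.toBasis i⟫ • ob j :=
        (ob.sum_repr' _).symm
    _ = ob.toBasis i := by
        simp_rw [key, ite_smul, one_smul, zero_smul, Finset.sum_ite_eq', Finset.mem_univ, if_true,
          OrthonormalBasis.coe_toBasis]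

/-- **The `ℤ`-span of an orthonormal basis is a self-dual lattice.** -/
theorem dualLattice_span_orthonormalBasis {ι : Type*} [Fintype ι] (ob : OrthonormalBasis ι ℝ V) :
    dualLattice (span ℤ (Set.range ob.toBasis)) = span ℤ (Set.range ob.toBasis) := by
  classical
  rw [dualLattice, LinearMap.BilinForm.dualSubmodule_span_of_basis (innerₗ V) innerₗ_nondegenerate,
    dualBasis_orthonormalBasis]

end PoissonSummation

namespace SchwartzWeil

open PoissonSummation

variable (E : Type) [NormedAddCommGroup E] [InnerProductSpace ℝ E] [FiniteDimensional ℝ E]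
  [MeasurableSpace E] [BorelSpace E]
  (L : Submodule ℤ E) [DiscreteTopology L] [IsZLattice ℝ L] (m : ℤ)

/-! ## 1. Theta distributions: `Θ_{L*}(𝓕 Φ) = covol(L) · Θ_L(Φ)` -/

/-- **Poisson summation, distribution form, any rank**: the theta distribution of the dual lattice evaluated on
`𝓕 Φ` is `covol(L)` times the theta distribution of `L` on `Φ`:
`thetaCLM L* 0 (𝓕 Φ) = covol(L) · thetaCLM L 0 Φ`. -/
theorem thetaCLM_dualLattice_fourier (Φ : 𝓢(E, ℂ)) :
    thetaCLM (dualLattice L) (0 : E) (𝓕 Φ) = ((ZLattice.covolume L : ℝ) : ℂ) * thetaCLM L (0 : E) Φ := by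
  simp only [thetaCLM_apply, zero_add]
  exact tsum_dualLattice_fourier L Φ

/-- Shifted form: `thetaCLM L* x (𝓕 Φ) = covol(L) · Σ_{v ∈ L} Φ(v) 𝐞(-⟪v, x⟫)`. -/
theorem thetaCLM_dualLattice_fourier_apply (Φ : 𝓢(E, ℂ)) (x : E) :
    thetaCLM (dualLattice L) x (𝓕 Φ) =
      ((ZLattice.covolume L : ℝ) : ℂ) * ∑' v : L, Φ (v : E) * Real.fourierChar (-⟪(v : E), x⟫) := by
  rw [thetaCLM_apply]
  exact tsum_dualLattice_fourier_translate L Φ x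

/-- Self-dual lattice: the theta distribution `thetaCLM L 0 = Σ_{v ∈ L} δ_v` is `𝓕`-invariant. -/
theorem thetaCLM_fourier_of_dualLattice_eq (h : dualLattice L = L) (Φ : 𝓢(E, ℂ)) :
    thetaCLM L (0 : E) (𝓕 Φ) = thetaCLM L (0 : E) Φ := by
  simp only [thetaCLM_apply, zero_add]
  exact tsum_fourier_eq_tsum_of_dualLattice_eq L Φ h

/-! ## 2. Weil's theta function of the model: `Θ^{L*}_{𝓕Φ}` against `Θ^{L}_{Φ}` -/

/-- **Weil's (39) for the Weyl element, any rank, at `S = 1`**: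
`theta E L* m (𝓕 Φ) 1 = covol(L) · theta E L m Φ 1`. -/
theorem theta_dualLattice_fourier_one (Φ : 𝓢(E, ℂ)) :
    theta E (dualLattice L) m (𝓕 Φ) 1 = ((ZLattice.covolume L : ℝ) : ℂ) * theta E L m Φ 1 := by
  rw [theta_eq_thetaCLM, theta_eq_thetaCLM, act_one, act_one, thetaCLM_dualLattice_fourier]

/-- **`Θ^{L*}_{𝓕Φ}(a, u) = u^m · covol(L) · Σ_{v ∈ L} Φ(v) 𝐞⟪v, a⟫`**: at a translation `a ∈ E = X_∞` the dual-lattice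
theta function of `𝓕 Φ` is the `L`-lattice sum of `Φ` twisted by the character `v ↦ 𝐞⟪v, a⟫`. -/
theorem theta_dualLattice_fourier (Φ : 𝓢(E, ℂ)) (a : E) (u : Circle) :
    theta E (dualLattice L) m (𝓕 Φ) (Multiplicative.ofAdd a, u) =
      ((u : ℂ) ^ m) * (((ZLattice.covolume L : ℝ) : ℂ) *
        ∑' v : L, Φ (v : E) * Real.fourierChar ⟪(v : E), a⟫) := by
  rw [theta_eq]
  congr 1
  simp only [toAdd_ofAdd]
  rw [tsum_dualLattice_fourier_translate L Φ (-a)]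
  simp only [inner_neg_right, neg_neg]

/-! ## 3. Self-dual lattices: exact `𝓕`-invariance of the model's theta kernel at the base point -/

omit [InnerProductSpace ℝ E] [FiniteDimensional ℝ E] [MeasurableSpace E] [BorelSpace E] [DiscreteTopology L]
  [IsZLattice ℝ L] in
/-- `theta` does not see which (`Prop`-valued) `DiscreteTopology` instance a lattice carries: equal submodules have
equal theta functions. -/
theorem theta_congr [NormedSpace ℝ E] [DiscreteTopology L] {N : Submodule ℤ E} [DiscreteTopology N] (h : N = L) :
    theta E N m = theta E L m := by
  subst h
  rfl

/-- **Self-dual `L`: `Θ_{𝓕Φ}(1) = Θ_Φ(1)`** in the Schrödinger–lattice model of any rank (Weil 1964 n° 41 (39),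
`s = d'(γ)`; pv14-g4's `theta_fourier_one` is the case `E = ℝ`, `L = ℤ`). -/
theorem theta_fourier_one_of_dualLattice_eq (h : dualLattice L = L) (Φ : 𝓢(E, ℂ)) :
    theta E L m (𝓕 Φ) 1 = theta E L m Φ 1 := by
  rw [← theta_congr E L m h, theta_dualLattice_fourier_one, covolume_eq_one_of_dualLattice_eq L h,
    Complex.ofReal_one, one_mul, theta_congr E L m h]

/-- The same through the `WeilThetaDatum` record `SchwartzWeil.datum E L m`. -/
theorem datum_theta_fourier_one_of_dualLattice_eq (h : dualLattice L = L) (Φ : 𝓢(E, ℂ)) :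
    (datum E L m).theta (𝓕 Φ) 1 = (datum E L m).theta Φ 1 :=
  theta_fourier_one_of_dualLattice_eq E L m h Φ

/-- And through prl1-g4's `WeilThetaModel` record (`schrodingerModel E L m Γ hΓ`, `SK = univ`):
`θ_{𝓕Φ}(1·L, 1·Γ) = θ_Φ(1·L, 1·Γ)` for a self-dual lattice `L`. -/
theorem schrodingerModel_θ_fourier_one_of_dualLattice_eq (h : dualLattice L = L) (Γ : Subgroup Circle)
    (hΓ : ∀ u ∈ Γ, u ^ m = 1) (Φ : 𝓢(E, ℂ)) :
    (schrodingerModel E L m Γ hΓ).θ ⟨𝓕 Φ, Set.mem_univ _⟩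
        (QuotientGroup.mk (1 : Multiplicative E), QuotientGroup.mk (1 : Circle)) =
      (schrodingerModel E L m Γ hΓ).θ ⟨Φ, Set.mem_univ _⟩
        (QuotientGroup.mk (1 : Multiplicative E), QuotientGroup.mk (1 : Circle)) := by
  rw [schrodingerModel_θ_mk, schrodingerModel_θ_mk]
  congr 1
  simp only [toAdd_one, zero_add]
  exact tsum_fourier_eq_tsum_of_dualLattice_eq L Φ h

/-- General `L`, through the model record: `θ^{L*}_{𝓕Φ}(1·L*, 1·Γ) = covol(L) · θ^{L}_{Φ}(1·L, 1·Γ)`. -/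
theorem schrodingerModel_θ_dualLattice_fourier_one (Γ : Subgroup Circle) (hΓ : ∀ u ∈ Γ, u ^ m = 1)
    (Φ : 𝓢(E, ℂ)) :
    (schrodingerModel E (dualLattice L) m Γ hΓ).θ ⟨𝓕 Φ, Set.mem_univ _⟩
        (QuotientGroup.mk (1 : Multiplicative E), QuotientGroup.mk (1 : Circle)) =
      ((ZLattice.covolume L : ℝ) : ℂ) * (schrodingerModel E L m Γ hΓ).θ ⟨Φ, Set.mem_univ _⟩
        (QuotientGroup.mk (1 : Multiplicative E), QuotientGroup.mk (1 : Circle)) := by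
  rw [schrodingerModel_θ_mk, schrodingerModel_θ_mk, mul_left_comm]
  congr 1
  simp only [toAdd_one, zero_add]
  exact tsum_dualLattice_fourier L Φ

end SchwartzWeil

end HodgeCM

end
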